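import Literature.NumberTheory.GaloisRepresentations.PhiGammaModuleRobba
import HarnessLib

/-!
# `PhiGammaModuleRobba`: `IsKPX d` is blind to class relabellings of `D_rig`

Companion file of `PhiGammaModuleRobba.lean` and `Trianguline.lean` (nothing there is restated), in the
spirit of `PhiGammaModuleRobbaDegenerate.lean`: a sorry-free record of what the ABSTRACT datum does and
does not determine.

In `PhiGammaModuleData p F E` the rule `Drig : FramedGaloisRep F E n → FramedPhiGammaModule ring n` is
constrained only through conjugacy classes — `Drig_conj`, `Drig_injective`, `Drig_one`, `Drig_rank_one`,
`Drig_matGamma_eq_one` — and of the five conjuncts of `PhiGammaModuleRobba.IsKPX d` only `HasDrigEtale`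
mentions `Drig`, again only up to isomorphism and essential image.  Hence ALL these axioms are invariant
under PRECOMPOSING `Drig` with a *class relabelling*: a self-map of each `FramedGaloisRep F E n` that
preserves and reflects conjugacy, meets every conjugacy class and fixes the class of `1` — e.g. the
transposition of the classes of two non-trivial representations `ρ₁, ρ₂` of one rank.  Contents:

* `FramedRep.IsConj`, `FramedRep.ClassRelabelling`, `ClassRelabelling.refl`,
  `ClassRelabelling.swap ρ₁ ρ₂ (h₁ : ρ₁ ≠ 1) (h₂ : ρ₂ ≠ 1)` with `swap_apply_left : (swap …).toFun ρ₁ = ρ₂`;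
* `PhiGammaModuleData.relabel 𝔇 σ`, `PhiGammaModuleRobba.relabel 𝓣 σ`: the SAME ring, topology, `φ`,
  `Γ_F^abs`-action, `gen`, `homToH1`, `IsEtale`, `charMod`, with `Drig := 𝔇.Drig ∘ σ`, all axioms
  re-verified (`relabel_ring`, `relabel_gen`, `relabel_homToH1`, `relabel_charMod`, `relabel_Drig`: `rfl`);
* `hasLiuFiniteness_relabel_iff`, `hasRankOneCohomology_relabel_iff`,
  `hasRankOneClassification_relabel_iff`, `hasCFTIdentification_relabel_iff` (definitional),
  `hasDrigEtale_relabel`, **`isKPX_relabel : 𝓣.IsKPX d → (𝓣.relabel σ).IsKPX d`**, and the headline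
  `exists_isKPX_relabel_drig_eq`: given `IsKPX d` and `ρ₁ ≠ 1`, `ρ₂ ≠ 1` of one rank, some relabelled
  datum (same ring, `H⁰/H¹/H²`, cup products, `gen`, `homToH1`, `ofChar`) has `IsKPX d` and ITS
  `D_rig(ρ₁)` is the old `D_rig(ρ₂)`.

So a hypothesis package "`∀ 𝔇, 𝔇.IsKPX d → P (𝔇.Drig ρ)`" asserts `P` of `D_rig` of EVERY `ρ' ≠ 1` of
the rank of `ρ` (once `ρ ≠ 1`), not of `ρ` alone; statements meant about the `(φ, Γ)`-module of one
Galois representation must add hypotheses pinning `Drig` (exactness and tensor-functoriality, the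
rank-one dictionary `D_rig(δ̂₁) = 𝓡(δ₁)` through the Artin map, Berger's `D_st`/`D_cris` comparison — cf.
`BergerDstOnPhiGamma.lean`), or fix ONE datum and phrase item-specific hypotheses about it.  (Observed on
route `Langlands/SteinbergWeightVelocity`; the interface is also posited by `NewtonPatching`, `CMFern`.)

## The genuine statement, for the record

For `F/ℚ_p`, `E/ℚ_p` finite and Berger's `D_rig^†` over the Robba ring `𝓡_E(π_F)`, `V ↦ 𝔻_rig(V)` "is
fully faithful and exact, and it commutes with base change" [cite: KedlayaPottharstXiao2014, Thm. 2.2.17],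
is tensor-functorial and yields the rank-one objects `𝓡_A(π_K)(δ₁) = 𝔻_rig(δ̂₁)` through the Artin map
[cite: KedlayaPottharstXiao2014, Construction 6.2.4]; a relabelled `Drig ∘ swap` is no longer exact, so
it violates THOSE properties — which the abstract datum does not record.  Nothing here obstructs proving
them for the genuine instance once it is constructed.

## What is deliberately NOT here

No statement about the genuine Robba ring; no named fact (everything is proved); no change to
`PhiGammaModuleData` / `PhiGammaModuleRobba`.

## Mathlib / Literature declarations used

`FramedRep`, `FramedRep.conj(_apply)` (`ContinuousRep.lean`); `PhiGammaModuleData`,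
`FramedPhiGammaModule.IsIso(.trans)` (`Trianguline.lean`); `PhiGammaModuleRobba`, `HasLiuFiniteness`,
`HasRankOneCohomology`, `HasRankOneClassification`, `HasCFTIdentification`, `HasDrigEtale`, `IsKPX`
(`PhiGammaModuleRobba.lean`); Mathlib `ContinuousMonoidHom.ext`, `ContinuousMonoidHom.coe_one`,
`Function.update_self`, `Function.update_of_ne`.

## References

* K. S. Kedlaya, J. Pottharst, L. Xiao, *Cohomology of arithmetic families of `(φ, Γ)`-modules*,
  JAMS 27 (2014), arXiv:1203.5718 — Thm. 2.2.17 (p. 15), Construction 6.2.4 (p. 40), read 2026-08-15.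
  [KedlayaPottharstXiao2014]
-/

noncomputable section

namespace Literature.NumberTheory.GaloisRepresentations

universe u v w

/-! ## Part 1. Conjugacy of framed representations; class relabellings -/

namespace FramedRep

variable {G : Type u} [Group G] [TopologicalSpace G] {A : Type v} [CommRing A] [TopologicalSpace A]
  [IsTopologicalRing A]

/-- `ρ'` is **conjugate** to `ρ` (same representation in another frame): `ρ' = P ρ P⁻¹` for some
`P ∈ GL_n(A)` (`FramedRep.conj`). [folklore] -/
def IsConj {n : ℕ} (ρ ρ' : FramedRep G A n) : Prop :=
  ∃ P : GL (Fin n) A, ρ' = FramedRep.conj P ρ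

/-- Conjugacy is reflexive (`P = 1`). [folklore] -/
lemma IsConj.rfl {n : ℕ} {ρ : FramedRep G A n} : ρ.IsConj ρ :=
  ⟨1, ContinuousMonoidHom.ext fun g => by simp⟩

/-- Conjugacy is symmetric (`P ↦ P⁻¹`). [folklore] -/
lemma IsConj.symm {n : ℕ} {ρ ρ' : FramedRep G A n} (h : ρ.IsConj ρ') : ρ'.IsConj ρ := by
  obtain ⟨P, rfl⟩ := h
  refine ⟨P⁻¹, ContinuousMonoidHom.ext fun g => ?_⟩
  simp only [conj_apply, inv_inv]
  group

/-- Conjugacy is transitive (`P, Q ↦ Q P`). [folklore] -/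
lemma IsConj.trans {n : ℕ} {ρ ρ' ρ'' : FramedRep G A n} (h : ρ.IsConj ρ') (h' : ρ'.IsConj ρ'') :
    ρ.IsConj ρ'' := by
  obtain ⟨P, rfl⟩ := h
  obtain ⟨Q, rfl⟩ := h'
  refine ⟨Q * P, ContinuousMonoidHom.ext fun g => ?_⟩
  simp only [conj_apply, _root_.mul_inv_rev]
  group

/-- The trivial representation is alone in its conjugacy class: `P · 1 · P⁻¹ = 1`. [folklore] -/
lemma conj_one_right {n : ℕ} (P : GL (Fin n) A) :
    FramedRep.conj P (1 : FramedRep G A n) = 1 :=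
  ContinuousMonoidHom.ext fun g => by simp

/-- `ρ` is conjugate to `1` iff `ρ = 1`. [folklore] -/
lemma isConj_one_iff {n : ℕ} (ρ : FramedRep G A n) : IsConj 1 ρ ↔ ρ = 1 :=
  ⟨fun ⟨P, hP⟩ => hP.trans (conj_one_right P), fun h => h ▸ IsConj.rfl⟩

variable (G A) in
/-- A **class relabelling** of the framed representations of `G` over `A`: in every rank `n` a
self-map `σ` of `FramedRep G A n` which PRESERVES and REFLECTS conjugacy, meets every conjugacy class and
fixes the class of `1` (so it induces a permutation of the conjugacy classes fixing `[1]`) — exactly what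
makes `Drig ∘ σ` satisfy the axioms of `PhiGammaModuleData` / `IsKPX` again
(`PhiGammaModuleData.relabel`, `PhiGammaModuleRobba.isKPX_relabel`). [folklore] -/
structure ClassRelabelling where
  /-- The self-map in rank `n`. -/
  toFun : ∀ {n : ℕ}, FramedRep G A n → FramedRep G A n
  /-- `σ` preserves conjugacy. -/
  isConj_map : ∀ {n : ℕ} {ρ ρ' : FramedRep G A n}, ρ.IsConj ρ' → (toFun ρ).IsConj (toFun ρ')
  /-- `σ` reflects conjugacy. -/
  isConj_of_map : ∀ {n : ℕ} {ρ ρ' : FramedRep G A n}, (toFun ρ).IsConj (toFun ρ') → ρ.IsConj ρ'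
  /-- `σ` meets every conjugacy class. -/
  exists_isConj : ∀ {n : ℕ} (ρ₀ : FramedRep G A n), ∃ ρ : FramedRep G A n, (toFun ρ).IsConj ρ₀
  /-- `σ` fixes the class of the trivial representation. -/
  isConj_map_one : ∀ n : ℕ, IsConj 1 (toFun (1 : FramedRep G A n))

namespace ClassRelabelling

/-- A class relabelling sends `1` to `1` (the class of `1` is `{1}`). [folklore] -/
lemma map_one (σ : ClassRelabelling G A) (n : ℕ) : σ.toFun (1 : FramedRep G A n) = 1 :=
  (isConj_one_iff _).1 (σ.isConj_map_one n)

variable (G A) in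
/-- The identity relabelling. [folklore] -/
def refl : ClassRelabelling G A where
  toFun ρ := ρ
  isConj_map h := h
  isConj_of_map h := h
  exists_isConj ρ₀ := ⟨ρ₀, IsConj.rfl⟩
  isConj_map_one _ := IsConj.rfl

open Classical in
/-- The rank-`m` core of the swap: exchange the conjugacy classes of `ρ₁` and `ρ₂` (every member of
`[ρ₁]` goes to `ρ₂`, every member of `[ρ₂] \ [ρ₁]` goes to `ρ₁`), identity elsewhere. [folklore] -/
def swapCore {m : ℕ} (ρ₁ ρ₂ : FramedRep G A m) (ρ : FramedRep G A m) : FramedRep G A m :=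
  if ρ₁.IsConj ρ then ρ₂ else if ρ₂.IsConj ρ then ρ₁ else ρ

section SwapCore

variable {m : ℕ} (ρ₁ ρ₂ : FramedRep G A m)

/-- `swapCore ρ₁ ρ₂ ρ₁ = ρ₂`. [folklore] -/
@[simp] lemma swapCore_left : swapCore ρ₁ ρ₂ ρ₁ = ρ₂ := by
  simp [swapCore, IsConj.rfl]

/-- On the class of `ρ₁` the value is `ρ₂`. [folklore] -/
lemma swapCore_of_isConj_left {ρ : FramedRep G A m} (h : ρ₁.IsConj ρ) : swapCore ρ₁ ρ₂ ρ = ρ₂ := by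
  simp [swapCore, h]

/-- On the class of `ρ₂` (off the class of `ρ₁`) the value is `ρ₁`. [folklore] -/
lemma swapCore_of_isConj_right {ρ : FramedRep G A m} (h₁ : ¬ ρ₁.IsConj ρ) (h₂ : ρ₂.IsConj ρ) :
    swapCore ρ₁ ρ₂ ρ = ρ₁ := by
  simp [swapCore, h₁, h₂]

/-- Off both classes the value is `ρ`. [folklore] -/
lemma swapCore_of_not_isConj {ρ : FramedRep G A m} (h₁ : ¬ ρ₁.IsConj ρ) (h₂ : ¬ ρ₂.IsConj ρ) :
    swapCore ρ₁ ρ₂ ρ = ρ := by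
  simp [swapCore, h₁, h₂]

/-- `swapCore` preserves conjugacy (conjugate arguments lie in the same case). [folklore] -/
lemma swapCore_isConj_map {ρ ρ' : FramedRep G A m} (h : ρ.IsConj ρ') :
    (swapCore ρ₁ ρ₂ ρ).IsConj (swapCore ρ₁ ρ₂ ρ') := by
  by_cases h₁ : ρ₁.IsConj ρ
  · rw [swapCore_of_isConj_left _ _ h₁, swapCore_of_isConj_left _ _ (h₁.trans h)]
    exact IsConj.rfl
  · have h₁' : ¬ ρ₁.IsConj ρ' := fun h' => h₁ (h'.trans h.symm)
    by_cases h₂ : ρ₂.IsConj ρ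
    · rw [swapCore_of_isConj_right _ _ h₁ h₂, swapCore_of_isConj_right _ _ h₁' (h₂.trans h)]
      exact IsConj.rfl
    · have h₂' : ¬ ρ₂.IsConj ρ' := fun h' => h₂ (h'.trans h.symm)
      rwa [swapCore_of_not_isConj _ _ h₁ h₂, swapCore_of_not_isConj _ _ h₁' h₂']

/-- `swapCore` is an involution up to conjugacy. [folklore] -/
lemma isConj_swapCore_swapCore (ρ : FramedRep G A m) :
    ρ.IsConj (swapCore ρ₁ ρ₂ (swapCore ρ₁ ρ₂ ρ)) := by
  by_cases h₁ : ρ₁.IsConj ρ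
  · rw [swapCore_of_isConj_left _ _ h₁]
    by_cases h₁₂ : ρ₁.IsConj ρ₂
    · rw [swapCore_of_isConj_left _ _ h₁₂]
      exact h₁.symm.trans h₁₂
    · rw [swapCore_of_isConj_right _ _ h₁₂ IsConj.rfl]
      exact h₁.symm
  · by_cases h₂ : ρ₂.IsConj ρ
    · rw [swapCore_of_isConj_right _ _ h₁ h₂, swapCore_left]
      exact h₂.symm
    · rw [swapCore_of_not_isConj _ _ h₁ h₂, swapCore_of_not_isConj _ _ h₁ h₂]
      exact IsConj.rfl

/-- `swapCore` preserves AND reflects conjugacy. [folklore] -/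
lemma swapCore_isConj_iff (ρ ρ' : FramedRep G A m) :
    (swapCore ρ₁ ρ₂ ρ).IsConj (swapCore ρ₁ ρ₂ ρ') ↔ ρ.IsConj ρ' :=
  ⟨fun h => ((isConj_swapCore_swapCore ρ₁ ρ₂ ρ).trans (swapCore_isConj_map ρ₁ ρ₂ h)).trans
      (isConj_swapCore_swapCore ρ₁ ρ₂ ρ').symm,
    swapCore_isConj_map ρ₁ ρ₂⟩

/-- `swapCore` meets every class. [folklore] -/
lemma exists_swapCore_isConj (ρ₀ : FramedRep G A m) : ∃ ρ, (swapCore ρ₁ ρ₂ ρ).IsConj ρ₀ :=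
  ⟨swapCore ρ₁ ρ₂ ρ₀, (isConj_swapCore_swapCore ρ₁ ρ₂ ρ₀).symm⟩

end SwapCore

/-- **The swap relabelling**: in rank `m`, exchange the conjugacy classes of two NON-TRIVIAL
representations `ρ₁ ≠ 1`, `ρ₂ ≠ 1` (identity in the other ranks, `Function.update`).  Non-triviality is
what keeps the class of `1` fixed. [folklore] -/
def swap {m : ℕ} (ρ₁ ρ₂ : FramedRep G A m) (h₁ : ρ₁ ≠ 1) (h₂ : ρ₂ ≠ 1) : ClassRelabelling G A where
  toFun {n} := Function.update (fun n (ρ : FramedRep G A n) => ρ) m (swapCore ρ₁ ρ₂) n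
  isConj_map {n ρ ρ'} h := by
    by_cases hn : n = m
    · subst hn
      simpa only [Function.update_self] using (swapCore_isConj_iff ρ₁ ρ₂ ρ ρ').2 h
    · simpa only [Function.update_of_ne hn] using h
  isConj_of_map {n ρ ρ'} h := by
    by_cases hn : n = m
    · subst hn
      exact (swapCore_isConj_iff ρ₁ ρ₂ ρ ρ').1 (by simpa only [Function.update_self] using h)
    · simpa only [Function.update_of_ne hn] using h
  exists_isConj {n} ρ₀ := by
    by_cases hn : n = m
    · subst hn
      simpa only [Function.update_self] using exists_swapCore_isConj ρ₁ ρ₂ ρ₀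
    · exact ⟨ρ₀, by simpa only [Function.update_of_ne hn] using (IsConj.rfl : ρ₀.IsConj ρ₀)⟩
  isConj_map_one n := by
    by_cases hn : n = m
    · subst hn
      have h₁' : ¬ ρ₁.IsConj 1 := fun h => h₁ ((isConj_one_iff ρ₁).1 h.symm)
      have h₂' : ¬ ρ₂.IsConj 1 := fun h => h₂ ((isConj_one_iff ρ₂).1 h.symm)
      rw [Function.update_self, swapCore_of_not_isConj ρ₁ ρ₂ h₁' h₂']
      exact IsConj.rfl
    · rw [Function.update_of_ne hn]
      exact IsConj.rfl

/-- In rank `m` the swap relabelling is `swapCore`. [folklore] -/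
lemma swap_apply {m : ℕ} (ρ₁ ρ₂ : FramedRep G A m) (h₁ : ρ₁ ≠ 1) (h₂ : ρ₂ ≠ 1) (ρ : FramedRep G A m) :
    (swap ρ₁ ρ₂ h₁ h₂).toFun ρ = swapCore ρ₁ ρ₂ ρ := by
  show Function.update (fun n (ρ : FramedRep G A n) => ρ) m (swapCore ρ₁ ρ₂) m ρ = _
  rw [Function.update_self]

/-- **The swap sends `ρ₁` to `ρ₂`.** [folklore] -/
@[simp] lemma swap_apply_left {m : ℕ} (ρ₁ ρ₂ : FramedRep G A m) (h₁ : ρ₁ ≠ 1) (h₂ : ρ₂ ≠ 1) :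
    (swap ρ₁ ρ₂ h₁ h₂).toFun ρ₁ = ρ₂ := by
  rw [swap_apply, swapCore_left]

end ClassRelabelling

end FramedRep

/-! ## Part 2. Relabelling the datum `PhiGammaModuleData` -/

namespace PhiGammaModuleData

variable {p : ℕ} [Fact p.Prime] {F : Type u} [Field F] [TopologicalSpace F]
  {E : Type v} [Field E] [TopologicalSpace E] [IsTopologicalRing E]

/-- **Relabelled datum**: the same `(φ, Γ)`-ring and rank-one objects, with `Drig := 𝔇.Drig ∘ σ` for a
class relabelling `σ`.  Every axiom of `PhiGammaModuleData` is re-verified: `Drig_conj` from "`σ`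
preserves conjugacy", `Drig_injective` from "`σ` reflects conjugacy", `Drig_one` from "`σ` fixes `[1]`",
`Drig_rank_one` and `Drig_matGamma_eq_one` for free. [folklore] -/
def relabel (𝔇 : PhiGammaModuleData.{u, v, w} p F E)
    (σ : FramedRep.ClassRelabelling (Field.absoluteGaloisGroup F) E) : PhiGammaModuleData.{u, v, w} p F E where
  ring := 𝔇.ring
  smul_eq_self := 𝔇.smul_eq_self
  Drig ρ := 𝔇.Drig (σ.toFun ρ)
  Drig_matGamma_eq_one ρ τ hτ := 𝔇.Drig_matGamma_eq_one (σ.toFun ρ) τ hτ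
  Drig_conj g ρ := by
    obtain ⟨g', hg'⟩ := σ.isConj_map (⟨g, rfl⟩ : FramedRep.IsConj ρ (FramedRep.conj g ρ))
    rw [hg']
    exact 𝔇.Drig_conj g' (σ.toFun ρ)
  Drig_injective ρ ρ' h := σ.isConj_of_map (𝔇.Drig_injective (σ.toFun ρ) (σ.toFun ρ') h)
  Drig_one n := by
    rw [σ.map_one n]
    exact 𝔇.Drig_one n
  charMod := 𝔇.charMod
  charMod_matGamma_eq_one := 𝔇.charMod_matGamma_eq_one
  charMod_one := 𝔇.charMod_one
  charMod_injective := 𝔇.charMod_injective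
  Drig_rank_one η := 𝔇.Drig_rank_one (σ.toFun η)

variable (𝔇 : PhiGammaModuleData.{u, v, w} p F E)
  (σ : FramedRep.ClassRelabelling (Field.absoluteGaloisGroup F) E)

/-- The relabelled datum has the same `(φ, Γ)`-ring. [folklore] -/
@[simp] lemma relabel_ring : (𝔇.relabel σ).ring = 𝔇.ring := rfl

/-- `D_rig` of the relabelled datum is `D_rig ∘ σ`. [folklore] -/
@[simp] lemma relabel_Drig {n : ℕ} (ρ : FramedGaloisRep F E n) : (𝔇.relabel σ).Drig ρ = 𝔇.Drig (σ.toFun ρ) :=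
  rfl

end PhiGammaModuleData

/-! ## Part 3. Relabelling the enriched datum; invariance of `IsKPX` -/

namespace PhiGammaModuleRobba

variable {p : ℕ} [Fact p.Prime] {F : Type u} [Field F] [TopologicalSpace F]
  {E : Type v} [Field E] [TopologicalSpace E] [IsTopologicalRing E]

/-- **Relabelled enriched datum**: `PhiGammaModuleData.relabel` on the underlying datum, and the SAME
topology, continuity witnesses, `gen`, `dense_gen`, `homToH1` and `IsEtale` (all of which live on the
unchanged ring). [folklore] -/
def relabel (𝓣 : PhiGammaModuleRobba.{u, v, w} p F E)
    (σ : FramedRep.ClassRelabelling (Field.absoluteGaloisGroup F) E) : PhiGammaModuleRobba.{u, v, w} p F E where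
  toPhiGammaModuleData := 𝓣.toPhiGammaModuleData.relabel σ
  topR := 𝓣.topR
  topRingR := 𝓣.topRingR
  continuous_frob := 𝓣.continuous_frob
  continuous_act := 𝓣.continuous_act
  continuous_orbit := 𝓣.continuous_orbit
  gen := 𝓣.gen
  dense_gen := 𝓣.dense_gen
  homToH1 := 𝓣.homToH1
  IsEtale := 𝓣.IsEtale

variable (𝓣 : PhiGammaModuleRobba.{u, v, w} p F E)
  (σ : FramedRep.ClassRelabelling (Field.absoluteGaloisGroup F) E)

/-- Same ring. [folklore] -/
@[simp] lemma relabel_ring : (𝓣.relabel σ).ring = 𝓣.ring := rfl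

/-- Same `γ_F`. [folklore] -/
@[simp] lemma relabel_gen : (𝓣.relabel σ).gen = 𝓣.gen := rfl

/-- Same local-class-field-theory map. [folklore] -/
lemma relabel_homToH1 : (𝓣.relabel σ).homToH1 = 𝓣.homToH1 := rfl

/-- Same rank-one objects. [folklore] -/
@[simp] lemma relabel_charMod (δ : Fˣ →ₜ* Eˣ) : (𝓣.relabel σ).charMod δ = 𝓣.charMod δ := rfl

/-- `D_rig` of the relabelled datum is `D_rig ∘ σ`. [folklore] -/
@[simp] lemma relabel_Drig {n : ℕ} (ρ : FramedGaloisRep F E n) : (𝓣.relabel σ).Drig ρ = 𝓣.Drig (σ.toFun ρ) :=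
  rfl

/-- Liu finiteness does not mention `Drig`: invariant (definitionally). [folklore] -/
lemma hasLiuFiniteness_relabel_iff (d : ℕ) : (𝓣.relabel σ).HasLiuFiniteness d ↔ 𝓣.HasLiuFiniteness d :=
  Iff.rfl

/-- Rank-one cohomology does not mention `Drig`: invariant (definitionally). [folklore] -/
lemma hasRankOneCohomology_relabel_iff (d : ℕ) :
    (𝓣.relabel σ).HasRankOneCohomology d ↔ 𝓣.HasRankOneCohomology d :=
  Iff.rfl

/-- Rank-one classification does not mention `Drig`: invariant (definitionally). [folklore] -/
lemma hasRankOneClassification_relabel_iff :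
    (𝓣.relabel σ).HasRankOneClassification ↔ 𝓣.HasRankOneClassification :=
  Iff.rfl

/-- The CFT identification does not mention `Drig`: invariant (definitionally). [folklore] -/
lemma hasCFTIdentification_relabel_iff :
    (𝓣.relabel σ).HasCFTIdentification ↔ 𝓣.HasCFTIdentification :=
  Iff.rfl

/-- **`HasDrigEtale` is preserved by relabelling**: `D_rig(σ ρ)` is continuous and étale because every
`D_rig` is; `IsEtale` is unchanged; essential surjectivity onto étale objects uses that `σ` meets every
conjugacy class (and `Drig_conj`). [folklore] -/
lemma hasDrigEtale_relabel (h : 𝓣.HasDrigEtale) : (𝓣.relabel σ).HasDrigEtale := by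
  obtain ⟨hcont, hiso, hsurj⟩ := h
  refine ⟨fun n ρ => hcont n (σ.toFun ρ), hiso, fun n D hcyc hD hEt => ?_⟩
  obtain ⟨ρ₀, hρ₀⟩ := hsurj n D hcyc hD hEt
  obtain ⟨ρ, g, hg⟩ := σ.exists_isConj ρ₀
  -- `Drig (σ ρ) ≅ Drig (conj g (σ ρ)) = Drig ρ₀ ≅ D`
  exact ⟨ρ, (hg ▸ 𝓣.Drig_conj g (σ.toFun ρ) : (𝓣.Drig (σ.toFun ρ)).IsIso (𝓣.Drig ρ₀)).trans hρ₀⟩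

/-- **`IsKPX d` is preserved by every class relabelling of `D_rig`.** [folklore] -/
theorem isKPX_relabel {d : ℕ} (h : 𝓣.IsKPX d) : (𝓣.relabel σ).IsKPX d :=
  ⟨(hasLiuFiniteness_relabel_iff 𝓣 σ d).2 h.1, (hasRankOneCohomology_relabel_iff 𝓣 σ d).2 h.2.1,
    (hasRankOneClassification_relabel_iff 𝓣 σ).2 h.2.2.1, (hasCFTIdentification_relabel_iff 𝓣 σ).2 h.2.2.2.1,
    hasDrigEtale_relabel 𝓣 σ h.2.2.2.2⟩

/-- **Headline: `IsKPX` does not pin `D_rig`.**  For a datum with `IsKPX d` and two non-trivial framed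
representations `ρ₁ ≠ 1`, `ρ₂ ≠ 1` of the same rank, some relabelled datum — with the SAME ring, `gen`,
`homToH1`, `IsEtale` and rank-one objects (`relabel_ring`, `relabel_gen`, `relabel_homToH1`,
`relabel_charMod` are `rfl`), hence literally the same `H⁰/H¹/H²`, cup products and `ofChar` — again
has `IsKPX d`, and its `D_rig(ρ₁)` is the original `D_rig(ρ₂)`. [folklore] -/
theorem exists_isKPX_relabel_drig_eq {d : ℕ} (h : 𝓣.IsKPX d) {m : ℕ} (ρ₁ ρ₂ : FramedGaloisRep F E m)
    (h₁ : ρ₁ ≠ 1) (h₂ : ρ₂ ≠ 1) :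
    ∃ σ : FramedRep.ClassRelabelling (Field.absoluteGaloisGroup F) E,
      (𝓣.relabel σ).IsKPX d ∧ (𝓣.relabel σ).Drig ρ₁ = 𝓣.Drig ρ₂ :=
  ⟨FramedRep.ClassRelabelling.swap ρ₁ ρ₂ h₁ h₂, 𝓣.isKPX_relabel _ h,
    by rw [relabel_Drig, FramedRep.ClassRelabelling.swap_apply_left]⟩

end PhiGammaModuleRobba

end Literature.NumberTheory.GaloisRepresentations
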